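import Summits.BirchSwinnertonDyer.BirchSwinnertonDyer.Theorems.UniversalToricDescentThinCombRigidity
import HarnessLib

/-!
# Thin-comb rigidity (crux idea `thin-comb-reflection` on the WALL `AdditiveSplitIMCInclusionAtThree`, item
# stmt-BirchSwinnertonDyer-20395) — Part V: the lemma is COORDINATE-FREE (transport along any constant-fixing
# automorphism of `Λ₂(𝒪)`) (helper, `--supports stmt-BirchSwinnertonDyer-20395`; cell `pub/bsd-wall`, lead `cruxlead-20395`)

WHY. The rigidity lemma K1 (`…ThinCombRigidity.lean`) is stated in (γ_𝔭, γ_𝔭')-coordinates of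
`Λ₂ = 𝒪⟦T₂⟧⟦T₁⟧`, where the thin comb is VERTICAL (`E_m(T₂) = Φ_{p^{m+1}}(1 + T₂)`). The tree's control map
`XGr₂.toXAc` and the printed algebraic functional equation (Nekovář 2006, utd-idea g40 note on the card) live in
(cyc, ac)-adapted coordinates `(U₁, U₂)` with `1 + U₁ = (1 + T₁)(1 + T₂)`, `1 + U₂ = 1 + T₁`, where the comb becomes the
family of lines `1 + U₁ = ζ·(1 + U₂)` (card S2). Rather than re-proving K1 there, this file transports it along ANY
ring automorphism `σ` of `Λ₂(𝒪)` fixing constants: comb divisibility modulo `σ(E_m(T₂))`, symmetry under a `ρ'`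
whose conjugate `σ⁻¹ ρ' σ` is a reflection, `⟹ G' ∣ p^a F'` (rational) / `G' ∣ F'` (integral).

Theorems only; nothing about elliptic curves; BSD is not proved by any of this.
References: Washington §7.1, §13.4 [cite: Washington1997, §7.1 and §13.4].
-/

set_option linter.dupNamespace false

noncomputable section

namespace Summit.BirchSwinnertonDyer.BirchSwinnertonDyer.Theorems.UniversalToricDescentThinComb

section Transport

variable {𝒪 : Type*} [CommRing 𝒪] {p : ℕ}

/-- **K1 in arbitrary coordinates, integral form.** Let `σ` be a ring automorphism of `Λ₂(𝒪)` fixing constants and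
`ρ'` an automorphism such that `σ⁻¹ ∘ ρ' ∘ σ` is a reflection. If `ρ' G' ∼ G'`, `ρ' F' ∼ F'` and
`F' ∈ (G', σ(E_m(T₂)))` on levels of unbounded order, then `G' ∣ F'`. [cite: Washington1997, §7.1 and §13.4] -/
theorem dvd_of_thinComb_transport (hK1 : CombReflectionRigidityInt 𝒪 p)
    (σ ρ' : PowerSeries (PowerSeries 𝒪) ≃+* PowerSeries (PowerSeries 𝒪))
    (hρ : IsReflection 𝒪 ((σ.trans ρ').trans σ.symm))
    {G' F' : PowerSeries (PowerSeries 𝒪)} (hG : Associated (ρ' G') G') (hF : Associated (ρ' F') F')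
    (hcomb : ∀ n : ℕ, ∃ m : ℕ, n ≤ m ∧ F' ∈ Ideal.span {G', σ (combElt 𝒪 p m)}) : G' ∣ F' := by
  have key : σ.symm G' ∣ σ.symm F' := by
    refine hK1 _ hρ (σ.symm G') (σ.symm F') ?_ ?_ ?_
    · obtain ⟨u, hu⟩ := hG
      refine ⟨(Units.map (σ.symm : PowerSeries (PowerSeries 𝒪) →* PowerSeries (PowerSeries 𝒪)) u), ?_⟩
      rw [Units.coe_map, MonoidHom.coe_coe, RingEquiv.trans_apply, RingEquiv.trans_apply,
        RingEquiv.apply_symm_apply, ← map_mul, hu]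
    · obtain ⟨u, hu⟩ := hF
      refine ⟨(Units.map (σ.symm : PowerSeries (PowerSeries 𝒪) →* PowerSeries (PowerSeries 𝒪)) u), ?_⟩
      rw [Units.coe_map, MonoidHom.coe_coe, RingEquiv.trans_apply, RingEquiv.trans_apply,
        RingEquiv.apply_symm_apply, ← map_mul, hu]
    · intro n
      obtain ⟨m, hnm, hmem⟩ := hcomb n
      obtain ⟨a, b, hab⟩ := Ideal.mem_span_pair.mp hmem
      refine ⟨m, hnm, Ideal.mem_span_pair.mpr ⟨σ.symm a, σ.symm b, ?_⟩⟩
      rw [← hab, map_add, map_mul, map_mul, RingEquiv.symm_apply_apply]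
  have := map_dvd (σ : PowerSeries (PowerSeries 𝒪) →+* PowerSeries (PowerSeries 𝒪)) key
  rwa [RingHom.coe_coe, RingEquiv.apply_symm_apply, RingEquiv.apply_symm_apply] at this

/-- **K1 in arbitrary coordinates, rational form**: the same with slack `p^t` on the comb gives `G' ∣ p^a·F'`
(`σ` must fix constants so that the slack is transported). [cite: Washington1997, §7.1 and §13.4] -/
theorem dvd_pow_mul_of_thinComb_transport (hK1 : CombReflectionRigidityRat 𝒪 p)
    (σ ρ' : PowerSeries (PowerSeries 𝒪) ≃+* PowerSeries (PowerSeries 𝒪)) (hσ : ∀ c : 𝒪, σ (const 𝒪 c) = const 𝒪 c)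
    (hρ : IsReflection 𝒪 ((σ.trans ρ').trans σ.symm))
    {G' F' : PowerSeries (PowerSeries 𝒪)} (hG : Associated (ρ' G') G') (hF : Associated (ρ' F') F')
    (hcomb : ∀ n : ℕ, ∃ m : ℕ, n ≤ m ∧ ∃ t : ℕ,
      const 𝒪 ((p : 𝒪) ^ t) * F' ∈ Ideal.span {G', σ (combElt 𝒪 p m)}) :
    ∃ a : ℕ, G' ∣ const 𝒪 ((p : 𝒪) ^ a) * F' := by
  have hσ' : ∀ c : 𝒪, σ.symm (const 𝒪 c) = const 𝒪 c := fun c => by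
    rw [RingEquiv.symm_apply_eq, hσ]
  have key : ∃ a : ℕ, σ.symm G' ∣ const 𝒪 ((p : 𝒪) ^ a) * σ.symm F' := by
    refine hK1 _ hρ (σ.symm G') (σ.symm F') ?_ ?_ ?_
    · obtain ⟨u, hu⟩ := hG
      refine ⟨(Units.map (σ.symm : PowerSeries (PowerSeries 𝒪) →* PowerSeries (PowerSeries 𝒪)) u), ?_⟩
      rw [Units.coe_map, MonoidHom.coe_coe, RingEquiv.trans_apply, RingEquiv.trans_apply,
        RingEquiv.apply_symm_apply, ← map_mul, hu]
    · obtain ⟨u, hu⟩ := hF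
      refine ⟨(Units.map (σ.symm : PowerSeries (PowerSeries 𝒪) →* PowerSeries (PowerSeries 𝒪)) u), ?_⟩
      rw [Units.coe_map, MonoidHom.coe_coe, RingEquiv.trans_apply, RingEquiv.trans_apply,
        RingEquiv.apply_symm_apply, ← map_mul, hu]
    · intro n
      obtain ⟨m, hnm, t, hmem⟩ := hcomb n
      obtain ⟨a, b, hab⟩ := Ideal.mem_span_pair.mp hmem
      refine ⟨m, hnm, t, Ideal.mem_span_pair.mpr ⟨σ.symm a, σ.symm b, ?_⟩⟩
      have := congrArg σ.symm hab
      rwa [map_add, map_mul, map_mul, map_mul, RingEquiv.symm_apply_apply, hσ'] at this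
  obtain ⟨a, c, hc⟩ := key
  refine ⟨a, σ c, ?_⟩
  have := congrArg σ hc
  rwa [map_mul, map_mul, RingEquiv.apply_symm_apply, RingEquiv.apply_symm_apply, ← hσ' ((p : 𝒪) ^ a),
    RingEquiv.apply_symm_apply] at this

end Transport


section LevelReduction

variable (𝒪 : Type*) [CommRing 𝒪] (p m : ℕ)

/-- **Comb divisibility at level `m` ⟺ divisibility in `𝒪_m⟦T₁⟧`.** The ideal-membership currency of
`ThinCombDvdInt/Rat` (`H ∈ (G, E_m(T₂))` in `Λ₂(𝒪)`) is EQUIVALENT to divisibility of the reductions in the power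
series ring over the level ring `𝒪_m = 𝒪⟦X⟧/(E_m)` (inner coefficients reduced modulo `E_m`) — the form in which an
Euler-system / Kolyvagin-system bound along the twisted `𝔭`-axis of level `m` is naturally stated (card K2).
[cite: Washington1997, §7.1 and §13.4] -/
theorem mem_span_combElt_iff_map_dvd (G H : PowerSeries (PowerSeries 𝒪)) :
    H ∈ Ideal.span {G, combElt 𝒪 p m} ↔
      PowerSeries.map (Ideal.Quotient.mk (Ideal.span {combSeries 𝒪 p m})) G ∣
        PowerSeries.map (Ideal.Quotient.mk (Ideal.span {combSeries 𝒪 p m})) H := by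
  classical
  set π := Ideal.Quotient.mk (Ideal.span {combSeries 𝒪 p m}) with hπ
  have hE : PowerSeries.map π (combElt 𝒪 p m) = 0 := by
    rw [combElt, PowerSeries.map_C, Ideal.Quotient.eq_zero_iff_mem.mpr (Ideal.mem_span_singleton_self _), map_zero]
  constructor
  · intro h
    obtain ⟨a, b, hab⟩ := Ideal.mem_span_pair.mp h
    refine ⟨PowerSeries.map π a, ?_⟩
    rw [← hab, map_add, map_mul, map_mul, hE, mul_zero, add_zero, mul_comm]
  · rintro ⟨q, hq⟩
    obtain ⟨q, rfl⟩ := PowerSeries.map_surjective π Ideal.Quotient.mk_surjective q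
    -- every coefficient of `H - G q` lies in `(E_m)`
    have hcoef : ∀ i, ∃ c : PowerSeries 𝒪,
        PowerSeries.coeff i (H - G * q) = c * combSeries 𝒪 p m := by
      intro i
      have := congrArg (PowerSeries.coeff i) hq
      rw [PowerSeries.coeff_map, ← map_mul, PowerSeries.coeff_map, Ideal.Quotient.eq,
        Ideal.mem_span_singleton'] at this
      obtain ⟨c, hc⟩ := this
      exact ⟨c, by rw [map_sub, hc]⟩
    choose c hc using hcoef
    rw [Ideal.mem_span_pair]
    refine ⟨q, PowerSeries.mk c, ?_⟩
    have : H - G * q = PowerSeries.mk c * combElt 𝒪 p m := by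
      ext i : 1
      rw [hc i, combElt, PowerSeries.coeff_mul_C, PowerSeries.coeff_mk]
    have h2 : H = G * q + PowerSeries.mk c * combElt 𝒪 p m := by rw [← this]; ring
    rw [h2]; ring

end LevelReduction

end Summit.BirchSwinnertonDyer.BirchSwinnertonDyer.Theorems.UniversalToricDescentThinComb

end
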